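import Summits.HubbardSuperconductivity.HubbardSuperconductivity.Theorems.NodalDiracTwistBridgeNodalToDWaveDiagonalParityFlipLoop

/-!
# Loop transport under the 90° rotation (crux `NodalDiracWeakCoupling`, line `birth`)

Route `HubbardSuperconductivity/NodalDiracTwist`, crux stmt-HubbardSuperconductivity-10370, skeleton
`Cruxes/NodalDiracWeakCoupling/Lines/birth.lean` v8, registered stub `stub_rotLoopTransport`.

The SIGN clause of the crux says that, about a centre `p`, the cyclic overlap products
`∏_i ⟨ψ_i, ψ_{i+1}⟩` of ALL choices of unit `(N, S^z = 0)`-sector ground states `ψ_i` of the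
spin-twisted Hubbard torus `H_L(U, φ)` (`spinTwistedHubbardTorus L U φ`) at the vertices
`p + r (cos 2πi/n, sin 2πi/n)` of the regular `n`-gon have negative real part. This file carries
that property from `p` to the rotated centre `R p = (-p₁, p₀)` when `4 ∣ n`:

* `rot3Covariance` — covariance of `H_L(U, φ)` under the inverse rotation `r 3 = (r 1)⁻¹` of the
  square torus, `Γ_{r 3} H_L(U, (φ₀, φ₁)) Γ_{r 3}⁻¹ = H_L(U, (φ₁, -φ₀))` (from the landed
  `stub_rotCovariance` and `rot2Covariance`, `r 3 = r 1 · r 2`);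
* `isGroundStateInSector_rot3` — `U_{r 3} = fockD4 (r 3)` transports sector ground states
  `H_L(U, (φ₀, φ₁)) ↝ H_L(U, (φ₁, -φ₀))`;
* `stub_rotLoopTransport` — given a unit ground-state choice `ψ'` on the `n`-gon about `R p`,
  `n = 4q`, the vectors `ψ_i = U_{r 3} ψ'_{i+q}` form a unit ground-state choice on the `n`-gon
  about `p` (`R (p + r(cos θ, sin θ)) = R p + r (cos (θ + π/2), sin (θ + π/2))` and
  `θ_i + π/2 = θ_{i+q}`), with the same cyclic overlap product (unitarity of `U_{r 3}` and the
  reindexing `i ↦ i + q`, a power of `finRotate n` commuting with `finRotate n`).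

## References

D. J. Scalapino, Phys. Rep. 250 (1995) 329, §2 (point group of the square lattice); S. Karakuzu,
K. Seki, S. Sorella, PRB 98 (2018) 075156, Sec. II D (twisted boundary conditions and lattice
symmetries); T. Fukui, Y. Hatsugai, H. Suzuki, J. Phys. Soc. Jpn. 74 (2005) 1674 (lattice link
variables / cyclic overlap products). No new definitions, no named facts.
-/

-- the mandated namespace repeats `HubbardSuperconductivity` (single-problem summit, D-0017)
set_option linter.dupNamespace false

noncomputable section

namespace Summit.HubbardSuperconductivity.HubbardSuperconductivity.Theorems.NodalDiracTwist

open Matrix Finset Literature.MathematicalPhysics.QuantumLattice Literature.Probability.LatticeModels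
open Summit.HubbardSuperconductivity.HubbardSuperconductivity.Theorems.NodalDiracTwist.BridgeNodalToDWave

/-! ### The inverse rotation `r 3` and the spin-twisted torus -/

section Rot3

variable (L : ℕ) [NeZero L]

/-- **Covariance under `r 3`** (the inverse rotation `(x₀, x₁) ↦ (x₁, -x₀)` of the square torus):
`Γ H_L(U, (φ₀, φ₁)) Γ⁻¹ = H_L(U, (φ₁, -φ₀))`, from `r 3 = r 1 · r 2`, `stub_rotCovariance` and
`rot2Covariance`. Scalapino, Phys. Rep. 250 (1995) 329, §2; Karakuzu–Seki–Sorella, PRB 98 (2018)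
075156, Sec. II D. [folklore] -/
theorem rot3Covariance (U : ℝ) (φ : Fin 2 → ℝ) :
    relabel (Orb.d4Perm (L := L) (DihedralGroup.r 3)) (spinTwistedHubbardTorus L U φ) =
      spinTwistedHubbardTorus L U ![φ 1, -φ 0] := by
  have h3 : (DihedralGroup.r 3 : DihedralGroup 4) = DihedralGroup.r 1 * DihedralGroup.r 2 := by
    rw [DihedralGroup.r_mul_r]; rfl
  rw [h3, map_mul, relabel_perm_mul, rot2Covariance, stub_rotCovariance]
  congr 1
  funext i
  fin_cases i <;> simp

/-- **The inverse rotation transports sector ground states**: if `χ` is a ground state of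
`H_L(U, (φ₀, φ₁))` in the sector `(N, S^z = M)`, then `U_{r 3} χ` is one of `H_L(U, (φ₁, -φ₀))`
(`rot3Covariance` + `IsGroundStateInSector.relabelVec`). Scalapino, Phys. Rep. 250 (1995) 329, §2.
[folklore] -/
theorem isGroundStateInSector_rot3 {U : ℝ} {φ : Fin 2 → ℝ} {N : ℕ} {M : ℝ}
    {χ : Fock (Orb (FermionTorus 2 L))}
    (hχ : IsGroundStateInSector (spinTwistedHubbardTorus L U φ) N M χ) :
    IsGroundStateInSector (spinTwistedHubbardTorus L U ![φ 1, -φ 0]) N M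
      ((fockD4 (L := L) (DihedralGroup.r 3)).val *ᵥ χ) := by
  have h := hχ.relabelVec (FermionTorus.ofTorusEquiv (d4SitePerm (L := L) (DihedralGroup.r 3)))
  rw [← Orb.d4Perm_eq_mapEquiv, rot3Covariance, relabelVec_eq_fockRelabel_mulVec] at h
  exact h

end Rot3

/-! ### Geometry of the `4q`-gon: the index shift `i ↦ i + q` is the rotation by `π/2` -/

section Geometry

/-- `(finRotate n)^s i = i + s (mod n)` on values. [folklore] -/
theorem val_finRotate_pow_apply {n : ℕ} (s : ℕ) (i : Fin n) :
    (((finRotate n ^ s) i : Fin n) : ℕ) = ((i : ℕ) + s) % n := by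
  -- adapted from Literature/Computability/Complexity/HardcoreInapproximabilityCyclesOrbits.lean
  -- (`iterate_finRotate_val`)
  haveI := i.neZero
  induction s with
  | zero => simp [Nat.mod_eq_of_lt i.isLt]
  | succ s ih =>
    rw [pow_succ', Equiv.Perm.mul_apply, finRotate_apply, Fin.val_add, ih, Fin.val_one',
      Nat.add_mod_mod, Nat.mod_add_mod, Nat.add_assoc]

/-- The vertex angles of the `4q`-gon: `θ_{(i+q) mod 4q} ≡ θ_i + π/2 (mod 2π)`, so
`cos θ_{(i+q) mod 4q} = -sin θ_i` and `sin θ_{(i+q) mod 4q} = cos θ_i` (`θ_j = 2πj/(4q)`).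
[folklore] -/
theorem cos_sin_angle_shift_quarter {q : ℕ} (hq : 0 < q) (i : ℕ) :
    Real.cos (2 * Real.pi * (((i + q) % (4 * q) : ℕ) : ℝ) / ((4 * q : ℕ) : ℝ)) =
        -Real.sin (2 * Real.pi * (i : ℝ) / ((4 * q : ℕ) : ℝ)) ∧
      Real.sin (2 * Real.pi * (((i + q) % (4 * q) : ℕ) : ℝ) / ((4 * q : ℕ) : ℝ)) =
        Real.cos (2 * Real.pi * (i : ℝ) / ((4 * q : ℕ) : ℝ)) := by
  have hq' : (q : ℝ) ≠ 0 := by exact_mod_cast hq.ne'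
  set k : ℕ := (i + q) / (4 * q)
  have hdm : (i + q) % (4 * q) + 4 * q * k = i + q := Nat.mod_add_div _ _
  have hcast : (((i + q) % (4 * q) : ℕ) : ℝ) = (i : ℝ) + q - 4 * q * k := by
    have h : ((((i + q) % (4 * q) + 4 * q * k : ℕ) : ℝ)) = ((i + q : ℕ) : ℝ) := by rw [hdm]
    push_cast at h
    linarith
  have hang : 2 * Real.pi * (((i + q) % (4 * q) : ℕ) : ℝ) / ((4 * q : ℕ) : ℝ) =
      2 * Real.pi * (i : ℝ) / ((4 * q : ℕ) : ℝ) + Real.pi / 2 - (k : ℝ) * (2 * Real.pi) := by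
    rw [hcast]
    push_cast
    field_simp
    ring
  rw [hang, Real.cos_sub_nat_mul_two_pi, Real.sin_sub_nat_mul_two_pi, Real.cos_add_pi_div_two,
    Real.sin_add_pi_div_two]
  exact ⟨rfl, rfl⟩

/-- **The rotation `R (φ₀, φ₁) = (-φ₁, φ₀)` maps the `4q`-gon about `p` onto the `4q`-gon about
`R p` with indices shifted by `q`**, in the form used for the pull-back by `r 3`: writing
`W = R p + r (cos θ_{(i+q) mod 4q}, sin θ_{(i+q) mod 4q})`, one has
`(W₁, -W₀) = p + r (cos θ_i, sin θ_i)`. [folklore] -/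
theorem rot3_vertex_eq (p : Fin 2 → ℝ) (r : ℝ) {q : ℕ} (hq : 0 < q) (i : ℕ) :
    (![(fun ν : Fin 2 => (![-p 1, p 0] : Fin 2 → ℝ) ν + r *
          (if ν = 0 then Real.cos (2 * Real.pi * (((i + q) % (4 * q) : ℕ) : ℝ) / ((4 * q : ℕ) : ℝ))
            else Real.sin (2 * Real.pi * (((i + q) % (4 * q) : ℕ) : ℝ) / ((4 * q : ℕ) : ℝ)))) 1,
        -(fun ν : Fin 2 => (![-p 1, p 0] : Fin 2 → ℝ) ν + r *
          (if ν = 0 then Real.cos (2 * Real.pi * (((i + q) % (4 * q) : ℕ) : ℝ) / ((4 * q : ℕ) : ℝ))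
            else Real.sin (2 * Real.pi * (((i + q) % (4 * q) : ℕ) : ℝ) / ((4 * q : ℕ) : ℝ)))) 0] :
        Fin 2 → ℝ) =
      fun ν : Fin 2 => p ν + r *
        (if ν = 0 then Real.cos (2 * Real.pi * (i : ℝ) / ((4 * q : ℕ) : ℝ))
          else Real.sin (2 * Real.pi * (i : ℝ) / ((4 * q : ℕ) : ℝ))) := by
  obtain ⟨hc, hs⟩ := cos_sin_angle_shift_quarter hq i
  simp only [hc, hs]
  funext ν
  fin_cases ν
  · simp
  · simp [add_comm]

end Geometry

/-! ### The stub -/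

/-- **Registered stub `stub_rotLoopTransport` of crux stmt-HubbardSuperconductivity-10370** (line
`birth` v8; `D₄` transport of loop products). The 90° rotation of the square torus
(`U_{r 1} = fockD4 (r 1)`, covariance `Γ H_L(U, φ) Γ⁻¹ = H_L(U, (−φ₁, φ₀))`, `stub_rotCovariance`)
maps the `n`-gon of radius `r` about `p` onto the `n`-gon about `(−p₁, p₀)` with indices shifted by
`n/4` when `4 ∣ n`, preserving sector ground states, unit norms and all overlaps; so negativity of
the cyclic overlap products of all unit ground-state choices transfers from `p` to `(−p₁, p₀)`:
pull a choice `ψ'` about `(−p₁, p₀)` back to `ψ_i = U_{r 3} ψ'_{i + n/4}` (`U_{r 3} = U_{r 1}⁻¹`,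
`isGroundStateInSector_rot3`, `rot3_vertex_eq`), apply the hypothesis, and reindex the cyclic
product by `(finRotate n)^(n/4)`. Scalapino, Phys. Rep. 250 (1995) 329, §2; Karakuzu–Seki–Sorella,
PRB 98 (2018) 075156, Sec. II D; Fukui–Hatsugai–Suzuki, J. Phys. Soc. Jpn. 74 (2005) 1674.
[folklore] -/
theorem stub_rotLoopTransport :
    ∀ (L : ℕ) [NeZero L] (U : ℝ) (N : ℕ) (p : Fin 2 → ℝ) (r : ℝ) (n : ℕ), 4 ∣ n →
      (∀ ψ : Fin n → Fock (Orb (FermionTorus 2 L)),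
        (∀ i : Fin n,
          IsGroundStateInSector (spinTwistedHubbardTorus L U
              (fun ν : Fin 2 => p ν + r *
                    (if ν = 0 then Real.cos (2 * Real.pi * (i : ℕ) / n)
                      else Real.sin (2 * Real.pi * (i : ℕ) / n)))) N 0 (ψ i) ∧
            star (ψ i) ⬝ᵥ ψ i = 1) →
        (∏ i : Fin n, star (ψ i) ⬝ᵥ ψ (finRotate n i)).re < 0) →
      ∀ ψ : Fin n → Fock (Orb (FermionTorus 2 L)),
        (∀ i : Fin n,
          IsGroundStateInSector (spinTwistedHubbardTorus L U
              (fun ν : Fin 2 => (![-p 1, p 0] : Fin 2 → ℝ) ν + r *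
                    (if ν = 0 then Real.cos (2 * Real.pi * (i : ℕ) / n)
                      else Real.sin (2 * Real.pi * (i : ℕ) / n)))) N 0 (ψ i) ∧
            star (ψ i) ⬝ᵥ ψ i = 1) →
        (∏ i : Fin n, star (ψ i) ⬝ᵥ ψ (finRotate n i)).re < 0 := by
  intro L _ U N p r n hn hNEG ψ' hψ'
  obtain ⟨q, rfl⟩ := hn
  -- the index shift `σ i = i + q (mod 4q)` and the inverse rotation `Γ = U_{r 3}`
  obtain ⟨σ, hσ⟩ : ∃ σ : Equiv.Perm (Fin (4 * q)), σ = finRotate (4 * q) ^ q := ⟨_, rfl⟩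
  obtain ⟨Γ, hΓ⟩ :
      ∃ Γ : Matrix (Finset (Orb (FermionTorus 2 L))) (Finset (Orb (FermionTorus 2 L))) ℂ,
        Γ = (fockD4 (L := L) (DihedralGroup.r 3)).val := ⟨_, rfl⟩
  have hΓuni : ∀ v w : Fock (Orb (FermionTorus 2 L)), star (Γ *ᵥ v) ⬝ᵥ (Γ *ᵥ w) = star v ⬝ᵥ w := by
    intro v w
    rw [hΓ, fockD4_apply]
    exact star_fockRelabel_mulVec_dotProduct_fockRelabel_mulVec _ v w
  -- `σ` commutes with `finRotate`
  have hσrot : ∀ i : Fin (4 * q), σ (finRotate (4 * q) i) = finRotate (4 * q) (σ i) := by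
    intro i
    rw [hσ, ← Equiv.Perm.mul_apply, ← Equiv.Perm.mul_apply, ← pow_succ, ← pow_succ']
  -- the pulled-back choice about `p`
  have key := hNEG (fun i => Γ *ᵥ ψ' (σ i)) (fun i => ?_)
  · -- same cyclic product
    have hprod : ∏ i : Fin (4 * q), star (Γ *ᵥ ψ' (σ i)) ⬝ᵥ (Γ *ᵥ ψ' (σ (finRotate (4 * q) i))) =
        ∏ i : Fin (4 * q), star (ψ' i) ⬝ᵥ ψ' (finRotate (4 * q) i) := by
      calc ∏ i : Fin (4 * q), star (Γ *ᵥ ψ' (σ i)) ⬝ᵥ (Γ *ᵥ ψ' (σ (finRotate (4 * q) i)))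
          = ∏ i : Fin (4 * q), star (ψ' (σ i)) ⬝ᵥ ψ' (finRotate (4 * q) (σ i)) := by
            refine Fintype.prod_congr _ _ fun i => ?_
            rw [hΓuni, hσrot]
        _ = ∏ i : Fin (4 * q), star (ψ' i) ⬝ᵥ ψ' (finRotate (4 * q) i) :=
            Equiv.prod_comp σ (fun j => star (ψ' j) ⬝ᵥ ψ' (finRotate (4 * q) j))
    rw [hprod] at key
    exact key
  · -- vertex `i`: `Γ ψ'_{σ i}` is a unit sector ground state at `p + r (cos θ_i, sin θ_i)`
    have hq : 0 < q := by have := i.pos; omega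
    obtain ⟨hGS, hunit⟩ := hψ' (σ i)
    refine ⟨?_, by rw [hΓuni]; exact hunit⟩
    have h := isGroundStateInSector_rot3 L hGS
    rw [hσ, val_finRotate_pow_apply, rot3_vertex_eq p r hq] at h
    rw [hΓ, hσ]
    exact h

end Summit.HubbardSuperconductivity.HubbardSuperconductivity.Theorems.NodalDiracTwist

end
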